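import Summits.QuantumFields.BalabanUV.T4Continuum.Spine.NE5.TwoRunPencilWalks
import Summits.QuantumFields.BalabanUV.T4Continuum.Spine.NE5.NeumannPencilCovariance
import Literature.MathematicalPhysics.QuantumFieldTheory.Balaban1983to89.B13TermWalkData
import Summits.QuantumFields.BalabanUV.T4Continuum.Spine.NE5.TwoRunTorusWalkFullModel

/-!
# Spine/NE5/TwoRunPencilDiagonal — the two-run pencil with the pencil parameter IN THE CONFIGURATION SLOT of the (v)⁺
# currency: from two runs' walk data + termwise `r`-closeness, the `b`-parametrised kernel families that the END
# theorems T37 §2 ∕ T39 ∕ T41 read are joint walk expansions ∕ walk-majorant families OVER `ℂ ∋ b`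
# (cell `pub-balaban-gaps`, seat `ne5` gen 12; gate (b) of `ne/NE5-GATELIST.md` in kernel form on the producer side)

WHY.  The END of row NE5 (T39 `TwoRunTorusNE5Records.ne5_of_records_symm_all_scales`, T41
`TwoRunTorusNE5Nonvacuous.ne5_of_structural_data`) consumes, per scale and per (2.14)-term, ONE record
`𝒦 : TermKernels c⁺ 4 N ν Nf ℂ` whose configuration slot `E := ℂ` IS the pencil parameter `b` (run A = `b = 0`, run B
= `b = 1`) with `TermWalkData 𝒦 (w j)`, i.e. joint walk expansions of `b ↦ G(σ,b)`, `b ↦ A(σ,b)` and walk majorants of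
`b ↦ A(σ,b)⁻¹` on the ball `‖b‖ < R_j`, `R_j ∝ s∕θ^j` (T38).  Gen 5 typed the pencil `K_A + t(K_B − K_A)` for each FIXED
`t` (`TwoRunPencilWalks.jointWalkExpansion_pencil_reach`, `NeumannPencilCovariance.walkMajorants_inv_pencil_reach`)
over the runs' own configuration space.  THIS FILE puts `t` into the configuration slot by the DIAGONAL `u = t = b`:
* §1 `jointWalkExpansion_pencil_diag` — two kernel families over `E = ℂ` that are joint walk expansions on a common
  skeleton with TERMWISE `r`-close terms (King's «difference of propagators on one line», CMP 102 p. 665, in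
  walk-weighted currency) give the family `b ↦ K_A(σ,b) + b·(K_B(σ,b) − K_A(σ,b))` as a `JointWalkExpansion` over `ℂ`
  on the ball of radius `R′ ≤ min(R, s∕r)` with amplitudes `(1+s)A_ω` and constant `(1+s)K̄` — for runs whose data do
  not depend on the slot (the NE5 situation at a fixed background) this is literally the pencil `K_A + b(K_B − K_A)`;
  every field is read pointwise at `t := b` from gen 5's fixed-`t` pencil, except analyticity in `b` (product rule).
* §2 `walkMajorants_inv_pencil_diag` — the covariance along the same diagonal, `b ↦ (A(σ,b) + b·P(σ,b))⁻¹`, is a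
  `WalkMajorants` family over `ℂ` with `b`-INDEPENDENT letters (constant `K̄_C(1 − q)⁻¹`, Neumann chains as terms), read
  pointwise at `t := b` from gen 5's `walkMajorants_inv_pencil_reach` ([B9] (3.130): every operator of the resolvent
  series walk-expanded); smallness `q = (mc₁)((mc₁)K̄_C(sK̄_E)c′)c′ < 1` in the reach `s`, NOT in the rate `r`.
* §3 `termWalkData_pencil_diag` — THE PRODUCER'S RECIPE IN ONE THEOREM: a record `𝒦 : TermKernels c d N ν Nf ℂ` whose
  Γ-kernel and precision ARE the diagonal pencils of two runs' families has `TermWalkData 𝒦 ⟨R′, ε′, κ′, (1+s)K̄_Γ,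
  (1+s)K̄_E, K̄_C(1−q)⁻¹, R_σ⟩` as soon as the two runs' Γ-kernels and precisions are joint walk expansions on common
  skeletons through `𝒦.X`, termwise `r`-close with `R′ ≤ min(R, s∕r)`, run A's covariance has walk data, and the Neumann
  letters hold (§1 twice + §2 with the direction `P = A_B − A_A`, terms `T^B_ω − T^A_ω`, amplitudes `r·A^E_ω` read from
  the closeness + the envelope steps `JointWalkExpansion.mono` ∕ `WalkMajorants.mono`).
* §4 (v2, appended) `differentiableOn_sigma_of_termwise` ∕ `differentiableOn_sigma_pencil_diag` — located point (x12) in the (v)⁺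
  currency: σ-holomorphy of a jointly walk-expanded kernel (any configuration space), hence of the diagonal pencil, from
  TERMWISE σ-holomorphy on the open polydisc (gen 9's `differentiableOn_sigma_of_hasSum` fed by the expansion's fields) —
  the END's binders `hAhol` ∕ `hGhol` for the pencil record, derived instead of assumed.
So a producer holding the two runs' (v)⁺ witnesses on a common skeleton, termwise `r_j`-close with `R_j·r_j ≤ s` (T38's
radius `R_j ∝ s∕θ^j`, i.e. `r_j = O(θ^j)` — rows NE2∕NE3), hands T37 §2 ∕ T39 their per-scale records `h𝒦` by §3 (T40
certifies that the scalar side conditions those records must meet are jointly satisfiable; T41 is the non-vacuity form).  Located junction unchanged ((r4′) of `ne/NE5.md`): the closeness is asked TERMWISE in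
walk-weighted currency — one rate drop weaker than entrywise kernels (gen 5's `jointWalkExpansion_pencil_dropped`).

HONEST FRAMING.  Bookkeeping over LANDED hypothesis shapes (`B13JointWalkExpansion`, gen 5's pencil files); the two
families, their closeness `r`, the reach `s` and every letter are HYPOTHESES; nothing of Bałaban's is constructed or
asserted (whether his `Γ_k`, `Δ^{(k)}`, `C^{(k)}` at two spacings admit such data is NODE O's (v)⁺ + rows NE2∕NE3);
NE5 NOT PRINTED ∕ NOT PROVED; leaves 0∕12; (D4) 0∕1; spine 0∕9.  Rung (B)+1 on a FIXED finite T⁴ — NOT continuum, NOT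
infinite volume, NOT mass gap, NOT Clay.  HONEST DEPENDENCY: continuum YM on T⁴ ⇐ BetaPertH ∧ nine spine estimates;
BetaPertH ⇐ (D1) ∧ (D4) ∧ CAP+tail.  0 sorry, 0 `def`.

Sources: [II] = T. Bałaban, CMP **116** (1988) [Balaban1988RG2Cluster] (1.5) p. 3, (1.11) p. 5, p. 13, p. 15, (2.16)
p. 16; [B9] = CMP **99** (1985) [Balaban1985BackgroundPropagators] Thm 3.10, (3.107)–(3.108) p. 416, (3.130) p. 421,
p. 422; C. King, CMP **102** (1986) [King1986] p. 665.  Nothing here is a claim about the Yang–Mills mass gap.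
-/

noncomputable section

namespace Summit.QuantumFields.BalabanUV.T4Continuum.Spine.NE5.TwoRunPencilDiagonal

open Metric Set Matrix Finset
open Literature.MathematicalPhysics.QuantumFieldTheory.Balaban1983to89
open Literature.MathematicalPhysics.QuantumFieldTheory.Balaban1983to89.B9SectDWalk (MajSumLe DomBy infConv chainConst chainDist)
open Literature.MathematicalPhysics.QuantumFieldTheory.Balaban1983to89.B9Thm34Ext (toB6)
open Literature.MathematicalPhysics.QuantumFieldTheory.Balaban1983to89.B9Thm37GlueTorus (torusGeom tdist1)
open Literature.MathematicalPhysics.QuantumFieldTheory.Balaban1983to89.TreeLengthTorus (TPt)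
open Literature.MathematicalPhysics.QuantumFieldTheory.Balaban1983to89.B5TorusCover (UT)
open Literature.MathematicalPhysics.QuantumFieldTheory.Balaban1983to89.B11SectG (RowSum)
open Literature.MathematicalPhysics.QuantumFieldTheory.Balaban1983to89.B13JointWalkExpansion
  (JointWalkExpansion WalkMajorants)
open Literature.MathematicalPhysics.QuantumFieldTheory.Balaban1983to89.B13TermWalkData (WalkConsts TermKernels TermWalkData)
open Summit.QuantumFields.BalabanUV.T4Continuum.Spine.NE5.TwoRunPencilWalks (jointWalkExpansion_pencil_reach)
open Summit.QuantumFields.BalabanUV.T4Continuum.Spine.NE5.NeumannPencilCovariance (walkMajorants_inv_pencil_reach)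

variable {d N' : ℕ} {ν : ℕ} {Nf : Fin ν → ℕ} [∀ i, NeZero (Nf i)]

/-! ## §1. The Γ-kernel and the precision: the diagonal pencil is a joint walk expansion over `ℂ` -/

section Joint

variable {p n : Type} {c : B13.Consts} {locp : p → UT Nf} {locn : n → UT Nf}
variable {KA KB : (TPt d N' → ℂ) → ℂ → Matrix p n ℂ}
variable {X : Finset (UT Nf)} {R ε kap Kbar RB εB kapB KbarB : ℝ}
variable {W : Type} {TA TB : W → (TPt d N' → ℂ) → ℂ → Matrix p n ℂ} {SX : Set W} {A AB : W → ℝ}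
variable {D : W → UT Nf → UT Nf → ℝ} {ρ ρB : ℝ}

/-- **THE DIAGONAL PENCIL IS A JOINT WALK EXPANSION OVER `ℂ`.**  Two kernel families over the configuration space
`ℂ`, joint walk expansions on the common skeleton `(W, SX, D, ρ)` and σ-region `X` (run A on the `R`-ball, run B on an
`R_B ≥ R`-ball), whose terms are `r`-close in walk-weighted currency, `‖T_B ω σ u − T_A ω σ u‖ ≤ r·A_ω e^{−ρD_ω}`:
then for every radius `0 < R′ ≤ R` with `R′ ≤ s∕r` the diagonal family `b ↦ K_A(σ,b) + b·(K_B(σ,b) − K_A(σ,b))` with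
terms `b ↦ T_A ω σ b + b·(T_B ω σ b − T_A ω σ b)` is a `JointWalkExpansion` on the `R′`-ball of `ℂ`, amplitudes
`(1+s)A_ω`, constant `(1+s)K̄`, the same `X`, drop `ε`, torus rate and walk rate.  For slot-independent data (run A's and
run B's kernels at one background) this is the two-run PENCIL with the pencil parameter in the (v)⁺ configuration slot —
the shape T39 ∕ T41 consume per term (`TermKernels … ℂ`). [cite: Balaban1988RG2Cluster, (1.5) p.3, (1.11) p.5, (2.16) p.16; Balaban1985BackgroundPropagators, Thm 3.10 p.416; King1986, p.665] -/
theorem jointWalkExpansion_pencil_diag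
    (hA : JointWalkExpansion c locp locn KA X R ε kap Kbar TA SX A D ρ)
    (hB : JointWalkExpansion c locp locn KB X RB εB kapB KbarB TB SX AB D ρB) (hRB : R ≤ RB)
    {r s R' : ℝ} (hr : 0 < r) (hs : 0 ≤ s) (hR'0 : 0 < R') (hR' : R' ≤ R) (hR's : R' ≤ s / r)
    (hdiff : ∀ ω, ∀ σ : TPt d N' → ℂ, (∀ j, ‖σ j‖ ≤ Real.exp c.κ₁) → ∀ u ∈ ball (0 : ℂ) R,
      ∀ i j, ‖TB ω σ u i j - TA ω σ u i j‖ ≤ r * (A ω * Real.exp (-(ρ * D ω (locp i) (locn j))))) :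
    JointWalkExpansion c locp locn (fun σ b => KA σ b + b • (KB σ b - KA σ b)) X R' ε kap ((1 + s) * Kbar)
      (fun ω σ b => TA ω σ b + b • (TB ω σ b - TA ω σ b)) SX (fun ω => (1 + s) * A ω) D ρ := by
  -- gen 5's fixed-`t` pencil, read on the diagonal `t := b`
  have P : ∀ b ∈ ball (0 : ℂ) R',
      JointWalkExpansion c locp locn (fun σ u => KA σ u + b • (KB σ u - KA σ u)) X R ε kap ((1 + s) * Kbar)
        (fun ω σ u => TA ω σ u + b • (TB ω σ u - TA ω σ u)) SX (fun ω => (1 + s) * A ω) D ρ := fun b hb =>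
    jointWalkExpansion_pencil_reach hA hB hRB hr hs hdiff ((mem_ball_zero_iff.1 hb).le.trans hR's)
  have hsub : ball (0 : ℂ) R' ⊆ ball (0 : ℂ) R := ball_subset_ball hR'
  have P0 := P 0 (mem_ball_self hR'0)
  exact
    { hasSum := fun σ hσ b hb i j => (P b hb).hasSum σ hσ b (hsub hb) i j
      termAnalytic := fun ω σ hσ i j => by
        have hTA := (hA.termAnalytic ω σ hσ i j).mono hsub
        have hTB := (hB.termAnalytic ω σ hσ i j).mono (hsub.trans (ball_subset_ball hRB))
        have h : DifferentiableOn ℂ (fun b : ℂ => TA ω σ b i j + b * (TB ω σ b i j - TA ω σ b i j))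
            (ball (0 : ℂ) R') := hTA.add (differentiableOn_id.mul (hTB.sub hTA))
        exact h.congr fun b _ => by
          simp only [Matrix.add_apply, Matrix.smul_apply, Matrix.sub_apply, smul_eq_mul]
      maj := fun ω σ hσ b hb i j => (P b hb).maj ω σ hσ b (hsub hb) i j
      majSum := P0.majSum
      indep := fun ω hω σ hσ => by
        simp only [zero_smul, add_zero]
        exact hA.indep ω hω σ hσ
      through := hA.through
      A_nonneg := P0.A_nonneg
      D_nonneg := hA.D_nonneg }

/-- **Both runs sit inside the disc**: with `r ≤ s` and `1 < R′` the members `b = 0` (run A) and `b = 1` (run B) belong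
to the `R′`-ball on which the diagonal pencil is expanded; at `b = 0, 1` the diagonal family IS run A's ∕ run B's own
kernel (`K_A(σ,0)`, `K_B(σ,1)`). [folklore] -/
theorem pencil_diag_members {R' : ℝ} (hR' : 1 < R') (σ : TPt d N' → ℂ) :
    (0 : ℂ) ∈ ball (0 : ℂ) R' ∧ (1 : ℂ) ∈ ball (0 : ℂ) R' ∧
      (KA σ 0 + (0 : ℂ) • (KB σ 0 - KA σ 0) = KA σ 0) ∧ (KA σ 1 + (1 : ℂ) • (KB σ 1 - KA σ 1) = KB σ 1) := by
  refine ⟨mem_ball_self (one_pos.trans hR'), by simpa using hR', by simp, ?_⟩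
  rw [one_smul, add_sub_cancel]

end Joint

/-! ## §2. The covariance: the inverse along the diagonal pencil is a walk-majorant family over `ℂ` -/

section Cov

variable {n : Type} [Fintype n] [DecidableEq n] {c₀ : B13.Consts} {locn : n → UT Nf}
variable {WC WP : Type}
variable {TC : WC → (TPt d N' → ℂ) → ℂ → Matrix n n ℂ} {Cm : (TPt d N' → ℂ) → ℂ → Matrix n n ℂ}
variable {AC : WC → ℝ} {DC : WC → UT Nf → UT Nf → ℝ}
variable {TP : WP → (TPt d N' → ℂ) → ℂ → Matrix n n ℂ} {Pm : (TPt d N' → ℂ) → ℂ → Matrix n n ℂ}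
variable {AE : WP → ℝ} {DP : WP → UT Nf → UT Nf → ℝ}
variable {A : (TPt d N' → ℂ) → ℂ → Matrix n n ℂ}
variable {R ρC rC κC KbarC ρP rP κP KbarE ρ ρs σ₁ c₁ σ' c' κs κ r s : ℝ} {m : ℕ}

/-- **THE COVARIANCE ALONG THE DIAGONAL PENCIL IS A WALK-MAJORANT FAMILY OVER `ℂ` WITH `b`-INDEPENDENT LETTERS.**  Data
as in gen 5's `NeumannPencilCovariance.walkMajorants_inv_pencil_reach`, over the configuration space `ℂ`: walk data of
the covariance `C = A⁻¹` of run A's precision (terms `T_C`, amplitudes `A_C`, per-term rate `ρ_C`, partial sums at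
`r_C` with constant `K̄_C`, torus rate `κ_C`), walk data of the pencil DIRECTION `P` with amplitudes `r·A_E(ω)` and partial
sums `r·K̄_E` (the two-run rate `r > 0`, termwise), `A·C = 1` on polydisc × ball, the fibre bound, two row-sum letters
of the torus geometry, the rate windows and the smallness `q = (mc₁)((mc₁)K̄_C(sK̄_E)c′)c′ < 1` in the REACH `s`.  Then
for every radius `0 < R′ ≤ R`, `R′ ≤ s∕r`, the diagonal family `b ↦ (A(σ,b) + b·P(σ,b))⁻¹` is a `WalkMajorants` family on
the `R′`-ball of `ℂ` with terms the Neumann chains (at `t := b`), amplitudes `chainConst`, distances `chainDist`, walk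
rate `ρ`, constant `K̄_C(1 − q)⁻¹`, torus rate `κ` — none of which mentions `b` or `r`.  This is the third walk object
(`hCov`) of `TermWalkData` for the pencil record. [cite: Balaban1985BackgroundPropagators, (3.130) p.421, p.422, (3.107)–(3.108) p.416; Balaban1988RG2Cluster, (1.5) p.3, p.13, (2.16) p.16] -/
theorem walkMajorants_inv_pencil_diag
    (hCsum : ∀ σ₀ : TPt d N' → ℂ, (∀ j, ‖σ₀ j‖ ≤ Real.exp c₀.κ₁) → ∀ u ∈ ball (0 : ℂ) R,
      ∀ i k, HasSum (fun ω => TC ω σ₀ u i k) (Cm σ₀ u i k))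
    (hCmaj : ∀ ω, ∀ σ₀ : TPt d N' → ℂ, (∀ j, ‖σ₀ j‖ ≤ Real.exp c₀.κ₁) → ∀ u ∈ ball (0 : ℂ) R,
      ∀ i k, ‖TC ω σ₀ u i k‖ ≤ AC ω * Real.exp (-(ρC * DC ω (locn i) (locn k))))
    (hCms : MajSumLe (g := toB6 (torusGeom Nf 0 0 0) 0 True) (fun ω a b => AC ω * Real.exp (-(rC * DC ω a b)))
      (fun a b => KbarC * Real.exp (-(κC * tdist1 Nf a b))))
    (hCdom : ∀ ω, DomBy (toB6 (torusGeom Nf 0 0 0) 0 True) (DC ω)) (hAC0 : ∀ ω, 0 ≤ AC ω)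
    (hPsum : ∀ σ₀ : TPt d N' → ℂ, (∀ j, ‖σ₀ j‖ ≤ Real.exp c₀.κ₁) → ∀ u ∈ ball (0 : ℂ) R,
      ∀ i k, HasSum (fun ω => TP ω σ₀ u i k) (Pm σ₀ u i k))
    (hPmaj : ∀ ω, ∀ σ₀ : TPt d N' → ℂ, (∀ j, ‖σ₀ j‖ ≤ Real.exp c₀.κ₁) → ∀ u ∈ ball (0 : ℂ) R,
      ∀ i k, ‖TP ω σ₀ u i k‖ ≤ r * AE ω * Real.exp (-(ρP * DP ω (locn i) (locn k))))
    (hPms : MajSumLe (g := toB6 (torusGeom Nf 0 0 0) 0 True) (fun ω a b => r * AE ω * Real.exp (-(rP * DP ω a b)))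
      (fun a b => r * KbarE * Real.exp (-(κP * tdist1 Nf a b))))
    (hPdom : ∀ ω, DomBy (toB6 (torusGeom Nf 0 0 0) 0 True) (DP ω)) (hAE0 : ∀ ω, 0 ≤ AE ω)
    (hAC : ∀ σ₀ : TPt d N' → ℂ, (∀ j, ‖σ₀ j‖ ≤ Real.exp c₀.κ₁) → ∀ u ∈ ball (0 : ℂ) R, A σ₀ u * Cm σ₀ u = 1)
    (hfib : ∀ y : UT Nf, (Finset.univ.filter fun k => locn k = y).card ≤ m)
    (hrow : RowSum (toB6 (torusGeom Nf 0 0 0) 0 True) σ₁ c₁) (hrow' : RowSum (toB6 (torusGeom Nf 0 0 0) 0 True) σ' c')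
    (hσ₁ : 0 ≤ σ₁) (hσ' : 0 ≤ σ') (hc₁ : 0 ≤ c₁) (hc' : 0 ≤ c')
    (hρ : 0 ≤ ρ) (hρs : ρ + σ₁ ≤ ρs) (hρsC : ρs ≤ ρC) (hρsP : ρs + σ₁ ≤ ρP) (hrC : rC ≤ ρ) (hrP : rP ≤ ρ)
    (hKC : 0 ≤ KbarC) (hKE : 0 ≤ KbarE)
    (hκs : 0 ≤ κs) (hκsP : κs ≤ κP) (hκsC : κs + σ' ≤ κC) (hκ : 0 ≤ κ) (hκC : κ ≤ κC) (hκκs : κ + σ' ≤ κs)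
    (hr : 0 < r) (hs : 0 ≤ s) {R' : ℝ} (hR'0 : 0 < R') (hR' : R' ≤ R) (hR's : R' ≤ s / r)
    (hq : (m * c₁) * ((m * c₁) * KbarC * (s * KbarE) * c') * c' < 1) :
    WalkMajorants c₀ locn locn (fun σ₀ b => (A σ₀ b + b • Pm σ₀ b)⁻¹) R' κ
      (KbarC * (1 - (m * c₁) * ((m * c₁) * KbarC * (s * KbarE) * c') * c')⁻¹)
      (fun (q : List (WC × WP) × WC) σ₀ b =>
        q.1.foldr (fun i M => (TC i.1 σ₀ b * ((-b) • TP i.2 σ₀ b)) * M) (TC q.2 σ₀ b))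
      (fun q => chainConst (m : ℝ) c₁ (fun i : WC × WP => (m * c₁) * (AC i.1 * (s * AE i.2))) (AC q.2) q.1)
      (fun q => chainDist (g := toB6 (torusGeom Nf 0 0 0) 0 True)
        (fun i : WC × WP => infConv (g := toB6 (torusGeom Nf 0 0 0) 0 True) (DC i.1) (DP i.2)) (DC q.2) q.1) ρ := by
  -- gen 5's fixed-`t` Neumann covariance, read on the diagonal `t := b`
  have Q : ∀ b ∈ ball (0 : ℂ) R',
      WalkMajorants c₀ locn locn (fun σ₀ u => (A σ₀ u + b • Pm σ₀ u)⁻¹) R κ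
        (KbarC * (1 - (m * c₁) * ((m * c₁) * KbarC * (s * KbarE) * c') * c')⁻¹)
        (fun (q : List (WC × WP) × WC) σ₀ u =>
          q.1.foldr (fun i M => (TC i.1 σ₀ u * ((-b) • TP i.2 σ₀ u)) * M) (TC q.2 σ₀ u))
        (fun q => chainConst (m : ℝ) c₁ (fun i : WC × WP => (m * c₁) * (AC i.1 * (s * AE i.2))) (AC q.2) q.1)
        (fun q => chainDist (g := toB6 (torusGeom Nf 0 0 0) 0 True)
          (fun i : WC × WP => infConv (g := toB6 (torusGeom Nf 0 0 0) 0 True) (DC i.1) (DP i.2)) (DC q.2) q.1) ρ :=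
    fun b hb => walkMajorants_inv_pencil_reach hCsum hCmaj hCms hCdom hAC0 hPsum hPmaj hPms hPdom hAE0 hAC hfib hrow
      hrow' hσ₁ hσ' hc₁ hc' hρ hρs hρsC hρsP hrC hrP hKC hKE hκs hκsP hκsC hκ hκC hκκs hr hs
      ((mem_ball_zero_iff.1 hb).le.trans hR's) hq
  have hsub : ball (0 : ℂ) R' ⊆ ball (0 : ℂ) R := ball_subset_ball hR'
  have Q0 := Q 0 (mem_ball_self hR'0)
  exact
    { hasSum := fun σ₀ hσ₀ b hb i k => (Q b hb).hasSum σ₀ hσ₀ b (hsub hb) i k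
      maj := fun q σ₀ hσ₀ b hb i k => (Q b hb).maj q σ₀ hσ₀ b (hsub hb) i k
      majSum := Q0.majSum
      A_nonneg := Q0.A_nonneg }

end Cov

/-! ## §3. The pencil RECORD: `TermWalkData` from the two runs' walk data, ONE theorem -/

section Record

variable {c : B13.Consts}

/-- Scaling a majorant family and its bound by the same non-negative constant preserves `MajSumLe`. [folklore] -/
theorem majSumLe_smul {g : B6.Geometry} {W : Type} {K : W → g.Site → g.Site → ℝ} {Kbar : g.Site → g.Site → ℝ}
    {C : ℝ} (hC : 0 ≤ C) (h : MajSumLe K Kbar) : MajSumLe (fun ω a b => C * K ω a b) (fun a b => C * Kbar a b) := by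
  intro S a b
  rw [← Finset.mul_sum]
  exact mul_le_mul_of_nonneg_left (h S a b) hC

/-- **THE PENCIL RECORD HAS `TermWalkData` — the producer's recipe in ONE theorem.**  Let `𝒦 : TermKernels c d N ν Nf ℂ`
be a record whose Γ-kernel and precision ARE the diagonal pencils of two runs' families,
`𝒦.G2 σ b = G_A(σ,b) + b·(G_B(σ,b) − G_A(σ,b))`, `𝒦.A2 σ b = A_A(σ,b) + b·(A_B(σ,b) − A_A(σ,b))` (for slot-independent runs:
the two-run pencil with `b` in the configuration slot; run A = `b = 0`, run B = `b = 1`).  Suppose: (Γ) run A's and run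
B's Γ-kernels are joint walk expansions on a common skeleton through `𝒦.X`, termwise `r`-close; (E) the same for the
precisions; (C) run A's covariance `C_A = A_A⁻¹` has walk data (terms, per-term rate `ρ_C`, sums, `DomBy`), the
precision walks dominate distance, the fibre bound `m`, two row-sum letters of the torus geometry, the rate windows of
gen 5's Neumann theorem and its smallness `q = (mc₁)((mc₁)K̄_C(sK̄_E)c′)c′ < 1` in the REACH `s`; (geometry) every row
bond is `R_σ`-far from `𝒦.X`.  Then for every radius `0 < R′ ≤ R` with `R′·r ≤ s` (i.e. `R′ ≤ s∕r`) and every common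
drop `ε′` and torus rate `κ′` below the runs' ones: `TermWalkData 𝒦 ⟨R′, ε′, κ′, (1+s)K̄_Γ, (1+s)K̄_E, K̄_C(1−q)⁻¹, R_σ⟩` —
§1 twice (Γ, E) + §2 (the direction `P = A_B − A_A` with terms `T^B_ω − T^A_ω`, amplitudes `r·A^E_ω` from the closeness)
+ the envelope steps `JointWalkExpansion.mono` ∕ `WalkMajorants.mono`.  With T38's radius `R_j ∝ s∕θ^j` this is
satisfiable iff `r = r_j = O(θ^j)`: rows NE2∕NE3's primitive two-run rate, King's «difference of propagators on one
line» in walk currency; the letters of the package do not mention `r`.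
[cite: Balaban1988RG2Cluster, (1.5) p.3, (1.11) p.5, p.13, p.15, (2.16) p.16; Balaban1985BackgroundPropagators, Thm 3.10 p.416, (3.130) p.421; King1986, p.665] -/
theorem termWalkData_pencil_diag (𝒦 : TermKernels c d N' ν Nf ℂ)
    {GA GB : (TPt d N' → ℂ) → ℂ → Matrix 𝒦.Λ (𝒦.Λ ⊕ 𝒦.C₀) ℂ} {AA AB : (TPt d N' → ℂ) → ℂ → Matrix 𝒦.Λ 𝒦.Λ ℂ}
    (hG2 : ∀ σ b, 𝒦.G2 σ b = GA σ b + b • (GB σ b - GA σ b))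
    (hA2 : ∀ σ b, 𝒦.A2 σ b = AA σ b + b • (AB σ b - AA σ b))
    -- (Γ) the Γ-kernels of the two runs: one skeleton, termwise `r`-close
    {WΓ : Type} {TΓA TΓB : WΓ → (TPt d N' → ℂ) → ℂ → Matrix 𝒦.Λ (𝒦.Λ ⊕ 𝒦.C₀) ℂ} {SXΓ : Set WΓ} {AΓ AΓB : WΓ → ℝ}
    {DΓ : WΓ → UT Nf → UT Nf → ℝ} {R RΓB ρΓ ρΓB εΓ εΓB kapΓ kapΓB KΓ KΓB r s : ℝ}
    (hΓA : JointWalkExpansion c 𝒦.locΛ 𝒦.locN GA 𝒦.X R εΓ kapΓ KΓ TΓA SXΓ AΓ DΓ ρΓ)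
    (hΓB : JointWalkExpansion c 𝒦.locΛ 𝒦.locN GB 𝒦.X RΓB εΓB kapΓB KΓB TΓB SXΓ AΓB DΓ ρΓB) (hRΓB : R ≤ RΓB)
    (hdiffΓ : ∀ ω, ∀ σ : TPt d N' → ℂ, (∀ j, ‖σ j‖ ≤ Real.exp c.κ₁) → ∀ u ∈ ball (0 : ℂ) R,
      ∀ i j, ‖TΓB ω σ u i j - TΓA ω σ u i j‖ ≤ r * (AΓ ω * Real.exp (-(ρΓ * DΓ ω (𝒦.locΛ i) (𝒦.locN j)))))
    -- (E) the precisions of the two runs: one skeleton, termwise `r`-close, walks dominating distance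
    {WE : Type} {TEA TEB : WE → (TPt d N' → ℂ) → ℂ → Matrix 𝒦.Λ 𝒦.Λ ℂ} {SXE : Set WE} {AE AEB : WE → ℝ}
    {DE : WE → UT Nf → UT Nf → ℝ} {REB ρE ρEB εE εEB kapE kapEB KE KEB : ℝ}
    (hEA : JointWalkExpansion c 𝒦.locΛ 𝒦.locΛ AA 𝒦.X R εE kapE KE TEA SXE AE DE ρE)
    (hEB : JointWalkExpansion c 𝒦.locΛ 𝒦.locΛ AB 𝒦.X REB εEB kapEB KEB TEB SXE AEB DE ρEB) (hREB : R ≤ REB)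
    (hdiffE : ∀ ω, ∀ σ : TPt d N' → ℂ, (∀ j, ‖σ j‖ ≤ Real.exp c.κ₁) → ∀ u ∈ ball (0 : ℂ) R,
      ∀ i j, ‖TEB ω σ u i j - TEA ω σ u i j‖ ≤ r * (AE ω * Real.exp (-(ρE * DE ω (𝒦.locΛ i) (𝒦.locΛ j)))))
    (hEdom : ∀ ω, DomBy (toB6 (torusGeom Nf 0 0 0) 0 True) (DE ω))
    -- (C) run A's covariance `C_A = A_A⁻¹` with its walk data, and the Neumann letters
    {WC : Type} {TC : WC → (TPt d N' → ℂ) → ℂ → Matrix 𝒦.Λ 𝒦.Λ ℂ} {Cm : (TPt d N' → ℂ) → ℂ → Matrix 𝒦.Λ 𝒦.Λ ℂ}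
    {AC : WC → ℝ} {DC : WC → UT Nf → UT Nf → ℝ} {ρC rC κC KbarC ρ ρs σ₁ c₁ σ' c' κs κ : ℝ} {m : ℕ}
    (hCsum : ∀ σ₀ : TPt d N' → ℂ, (∀ j, ‖σ₀ j‖ ≤ Real.exp c.κ₁) → ∀ u ∈ ball (0 : ℂ) R,
      ∀ i k, HasSum (fun ω => TC ω σ₀ u i k) (Cm σ₀ u i k))
    (hCmaj : ∀ ω, ∀ σ₀ : TPt d N' → ℂ, (∀ j, ‖σ₀ j‖ ≤ Real.exp c.κ₁) → ∀ u ∈ ball (0 : ℂ) R,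
      ∀ i k, ‖TC ω σ₀ u i k‖ ≤ AC ω * Real.exp (-(ρC * DC ω (𝒦.locΛ i) (𝒦.locΛ k))))
    (hCms : MajSumLe (g := toB6 (torusGeom Nf 0 0 0) 0 True) (fun ω a b => AC ω * Real.exp (-(rC * DC ω a b)))
      (fun a b => KbarC * Real.exp (-(κC * tdist1 Nf a b))))
    (hCdom : ∀ ω, DomBy (toB6 (torusGeom Nf 0 0 0) 0 True) (DC ω)) (hAC0 : ∀ ω, 0 ≤ AC ω)
    (hAC : ∀ σ₀ : TPt d N' → ℂ, (∀ j, ‖σ₀ j‖ ≤ Real.exp c.κ₁) → ∀ u ∈ ball (0 : ℂ) R, AA σ₀ u * Cm σ₀ u = 1)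
    (hfib : ∀ y : UT Nf, (Finset.univ.filter fun k => 𝒦.locΛ k = y).card ≤ m)
    (hrow : RowSum (toB6 (torusGeom Nf 0 0 0) 0 True) σ₁ c₁) (hrow' : RowSum (toB6 (torusGeom Nf 0 0 0) 0 True) σ' c')
    (hσ₁ : 0 ≤ σ₁) (hσ' : 0 ≤ σ') (hc₁ : 0 ≤ c₁) (hc' : 0 ≤ c')
    (hρ : 0 ≤ ρ) (hρs : ρ + σ₁ ≤ ρs) (hρsC : ρs ≤ ρC) (hρsE : ρs + σ₁ ≤ ρE) (hrC : rC ≤ ρ) (hrE : ρE - εE ≤ ρ)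
    (hKC : 0 ≤ KbarC) (hKΓ0 : 0 ≤ KΓ) (hKE0 : 0 ≤ KE)
    (hκs : 0 ≤ κs) (hκsE : κs ≤ kapE) (hκsC : κs + σ' ≤ κC) (hκ : 0 ≤ κ) (hκC : κ ≤ κC) (hκκs : κ + σ' ≤ κs)
    (hq : (m * c₁) * ((m * c₁) * KbarC * (s * KE) * c') * c' < 1)
    -- the package: radius `R′ ≤ min(R, s∕r)`, common drop and torus rate, σ-distance
    (hr : 0 < r) (hs : 0 ≤ s) {R' : ℝ} (hR'0 : 0 < R') (hR' : R' ≤ R) (hR's : R' ≤ s / r)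
    {Rσ : ℝ} (hfar : ∀ b : 𝒦.Λ, ∀ z ∈ 𝒦.X, Rσ ≤ tdist1 Nf (𝒦.locΛ b) z)
    {ε' kap' : ℝ} (hε'Γ : ε' ≤ εΓ) (hε'E : ε' ≤ εE) (hkap'Γ : kap' ≤ kapΓ) (hkap'E : kap' ≤ kapE) (hkap'κ : kap' ≤ κ) :
    TermWalkData 𝒦
      ⟨R', ε', kap', (1 + s) * KΓ, (1 + s) * KE,
        KbarC * (1 - (m * c₁) * ((m * c₁) * KbarC * (s * KE) * c') * c')⁻¹, Rσ⟩ := by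
  have hKC' : 0 ≤ KbarC * (1 - (m * c₁) * ((m * c₁) * KbarC * (s * KE) * c') * c')⁻¹ :=
    mul_nonneg hKC (inv_nonneg.2 (by linarith))
  -- (Γ) and (E): §1, then the envelope step to the common drop ∕ torus rate
  have JΓ := (jointWalkExpansion_pencil_diag hΓA hΓB hRΓB hr hs hR'0 hR' hR's hdiffΓ).mono le_rfl hε'Γ hkap'Γ
    (by positivity) le_rfl
  have JE := (jointWalkExpansion_pencil_diag hEA hEB hREB hr hs hR'0 hR' hR's hdiffE).mono le_rfl hε'E hkap'E
    (by positivity) le_rfl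
  -- (C): the direction `P = A_B − A_A` with terms `T^B_ω − T^A_ω` and amplitudes `r·A^E_ω` from the closeness, then §2
  have hPsum : ∀ σ₀ : TPt d N' → ℂ, (∀ j, ‖σ₀ j‖ ≤ Real.exp c.κ₁) → ∀ u ∈ ball (0 : ℂ) R,
      ∀ i k, HasSum (fun ω => (TEB ω σ₀ u - TEA ω σ₀ u) i k) ((AB σ₀ u - AA σ₀ u) i k) :=
    fun σ₀ hσ₀ u hu i k => by
      simp only [Matrix.sub_apply]
      exact (hEB.hasSum σ₀ hσ₀ u (ball_subset_ball hREB hu) i k).sub (hEA.hasSum σ₀ hσ₀ u hu i k)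
  have hPmaj : ∀ ω, ∀ σ₀ : TPt d N' → ℂ, (∀ j, ‖σ₀ j‖ ≤ Real.exp c.κ₁) → ∀ u ∈ ball (0 : ℂ) R,
      ∀ i k, ‖(TEB ω σ₀ u - TEA ω σ₀ u) i k‖ ≤ r * AE ω * Real.exp (-(ρE * DE ω (𝒦.locΛ i) (𝒦.locΛ k))) :=
    fun ω σ₀ hσ₀ u hu i k => by rw [Matrix.sub_apply, mul_assoc]; exact hdiffE ω σ₀ hσ₀ u hu i k
  have hPms : MajSumLe (g := toB6 (torusGeom Nf 0 0 0) 0 True)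
      (fun ω a b => r * AE ω * Real.exp (-((ρE - εE) * DE ω a b)))
      (fun a b => r * KE * Real.exp (-(kapE * tdist1 Nf a b))) := by
    have h := majSumLe_smul hr.le hEA.majSum
    intro S a b
    simpa only [mul_assoc] using h S a b
  have Cov := (walkMajorants_inv_pencil_diag (A := AA) (Pm := fun σ₀ u => AB σ₀ u - AA σ₀ u)
    (TP := fun ω σ₀ u => TEB ω σ₀ u - TEA ω σ₀ u) hCsum hCmaj hCms hCdom hAC0 hPsum hPmaj hPms hEdom hEA.A_nonneg
    hAC hfib hrow hrow' hσ₁ hσ' hc₁ hc' hρ hρs hρsC hρsE hrC hrE hKC hKE0 hκs hκsE hκsC hκ hκC hκκs hr hs hR'0 hR'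
    hR's hq).mono le_rfl hkap'κ hKC' le_rfl
  -- the record's kernels ARE the diagonal pencils
  have eG : 𝒦.G2 = fun σ b => GA σ b + b • (GB σ b - GA σ b) := funext fun σ => funext fun b => hG2 σ b
  have eA : 𝒦.A2 = fun σ b => AA σ b + b • (AB σ b - AA σ b) := funext fun σ => funext fun b => hA2 σ b
  refine ⟨?_, ?_, ?_, hfar⟩
  · rw [eG]; exact ⟨WΓ, _, SXΓ, _, DΓ, ρΓ, JΓ⟩
  · rw [eA]; exact ⟨WE, _, SXE, _, DE, ρE, JE⟩
  · rw [eA]; exact ⟨_, _, _, _, ρ, Cov⟩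

end Record

/-! ## §4. Located point (x12) for the pencil record: σ-holomorphy of the kernels from TERMWISE σ-holomorphy -/

section Sigma

variable [NeZero N'] {p n : Type} {c : B13.Consts} {locp : p → UT Nf} {locn : n → UT Nf}
variable {E : Type*} [NormedAddCommGroup E] [NormedSpace ℂ E]
variable {K : (TPt d N' → ℂ) → E → Matrix p n ℂ} {X : Finset (UT Nf)} {R ε kap Kbar : ℝ}
variable {W : Type} {T : W → (TPt d N' → ℂ) → E → Matrix p n ℂ} {SX : Set W} {A : W → ℝ}
variable {D : W → UT Nf → UT Nf → ℝ} {ρ : ℝ}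

/-- **(x12) IN THE (v)⁺ CURRENCY — σ-holomorphy of a jointly walk-expanded kernel from TERMWISE σ-holomorphy.**  If
`K` has a `JointWalkExpansion` (any configuration space `E`) and, at a configuration `u` of the ball, every walk term
`σ ↦ T_ω(σ,u)(i,j)` is complex differentiable on the OPEN `e^{κ₁}`-polydisc (structurally free for Bałaban's terms: an
`s`-monomial times σ-independent operators, [II] (1.11)), then `σ ↦ K(σ,u)(i,j)` is complex differentiable there — gen
9's `TwoRunTorusWalkFullModel.differentiableOn_sigma_of_hasSum` (g1-p2's Cauchy-estimate theorem underneath) fed with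
the expansion's `hasSum`, `maj` and full-rate `majSum`.  This is the binder `hAhol` ∕ `hGhol` of T39
`ne5_of_records_symm_all_scales` for a record at `c⁺` (whose polydisc radius is `e^{κ₁+1}`), DERIVED from one extra
termwise datum instead of assumed. [cite: Balaban1988RG2Cluster, (1.11) p.5, p.13, p.15; Balaban1985BackgroundPropagators, Thm 3.10 p.416] -/
theorem differentiableOn_sigma_of_termwise
    (h : JointWalkExpansion c locp locn K X R ε kap Kbar T SX A D ρ) (hε : 0 ≤ ε) {u : E} (hu : u ∈ ball (0 : E) R)
    (hTσ : ∀ ω i j, DifferentiableOn ℂ (fun σ => T ω σ u i j) {σ : TPt d N' → ℂ | ∀ j, σ j ∈ ball (0 : ℂ) (Real.exp c.κ₁)})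
    (i : p) (j : n) :
    DifferentiableOn ℂ (fun σ => K σ u i j) {σ : TPt d N' → ℂ | ∀ j, σ j ∈ ball (0 : ℂ) (Real.exp c.κ₁)} := by
  have hle : ∀ σ : TPt d N' → ℂ, (∀ j, σ j ∈ ball (0 : ℂ) (Real.exp c.κ₁)) → ∀ j, ‖σ j‖ ≤ Real.exp c.κ₁ :=
    fun σ hσ j => (mem_ball_zero_iff.1 (hσ j)).le
  exact TwoRunTorusWalkFullModel.differentiableOn_sigma_of_hasSum locp locn h.A_nonneg (Real.exp_pos _) u
    (fun σ hσ i j => h.hasSum σ (hle σ hσ) u hu i j) hTσ (fun ω σ hσ i j => h.maj ω σ (hle σ hσ) u hu i j)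
    (h.majSum_full hε) i j

end Sigma

section SigmaPencil

variable [NeZero N'] {p n : Type} {c : B13.Consts} {locp : p → UT Nf} {locn : n → UT Nf}
variable {KA KB : (TPt d N' → ℂ) → ℂ → Matrix p n ℂ}
variable {X : Finset (UT Nf)} {R ε kap Kbar RB εB kapB KbarB : ℝ}
variable {W : Type} {TA TB : W → (TPt d N' → ℂ) → ℂ → Matrix p n ℂ} {SX : Set W} {A AB : W → ℝ}
variable {D : W → UT Nf → UT Nf → ℝ} {ρ ρB : ℝ}

/-- **The diagonal pencil's σ-holomorphy from the two runs' TERMWISE σ-holomorphy** (the binders `hAhol` ∕ `hGhol` of the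
END for the pencil record, discharged): under the hypotheses of `jointWalkExpansion_pencil_diag` (with `0 ≤ ε`), if at a
pencil parameter `b` of the `R′`-ball both runs' terms `σ ↦ T^A_ω(σ,b)(i,j)`, `σ ↦ T^B_ω(σ,b)(i,j)` are complex
differentiable on the open `e^{κ₁}`-polydisc, so is `σ ↦ (K_A(σ,b) + b·(K_B(σ,b) − K_A(σ,b)))(i,j)`.
[cite: Balaban1988RG2Cluster, (1.11) p.5, p.15; Balaban1985BackgroundPropagators, Thm 3.10 p.416] -/
theorem differentiableOn_sigma_pencil_diag
    (hA : JointWalkExpansion c locp locn KA X R ε kap Kbar TA SX A D ρ)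
    (hB : JointWalkExpansion c locp locn KB X RB εB kapB KbarB TB SX AB D ρB) (hRB : R ≤ RB)
    {r s R' : ℝ} (hr : 0 < r) (hs : 0 ≤ s) (hR'0 : 0 < R') (hR' : R' ≤ R) (hR's : R' ≤ s / r) (hε : 0 ≤ ε)
    (hdiff : ∀ ω, ∀ σ : TPt d N' → ℂ, (∀ j, ‖σ j‖ ≤ Real.exp c.κ₁) → ∀ u ∈ ball (0 : ℂ) R,
      ∀ i j, ‖TB ω σ u i j - TA ω σ u i j‖ ≤ r * (A ω * Real.exp (-(ρ * D ω (locp i) (locn j)))))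
    {b : ℂ} (hb : b ∈ ball (0 : ℂ) R')
    (hTAσ : ∀ ω i j, DifferentiableOn ℂ (fun σ => TA ω σ b i j) {σ : TPt d N' → ℂ | ∀ j, σ j ∈ ball (0 : ℂ) (Real.exp c.κ₁)})
    (hTBσ : ∀ ω i j, DifferentiableOn ℂ (fun σ => TB ω σ b i j) {σ : TPt d N' → ℂ | ∀ j, σ j ∈ ball (0 : ℂ) (Real.exp c.κ₁)})
    (i : p) (j : n) :
    DifferentiableOn ℂ (fun σ => (KA σ b + b • (KB σ b - KA σ b)) i j)
      {σ : TPt d N' → ℂ | ∀ j, σ j ∈ ball (0 : ℂ) (Real.exp c.κ₁)} := by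
  have J := jointWalkExpansion_pencil_diag hA hB hRB hr hs hR'0 hR' hR's hdiff
  refine differentiableOn_sigma_of_termwise J hε hb (fun ω i' j' => ?_) i j
  have h1 := hTAσ ω i' j'
  have h2 := hTBσ ω i' j'
  have h : DifferentiableOn ℂ (fun σ => TA ω σ b i' j' + b * (TB ω σ b i' j' - TA ω σ b i' j'))
      {σ : TPt d N' → ℂ | ∀ j, σ j ∈ ball (0 : ℂ) (Real.exp c.κ₁)} :=
    h1.add ((differentiableOn_const b).mul (h2.sub h1))
  exact h.congr fun σ _ => by simp only [Matrix.add_apply, Matrix.smul_apply, Matrix.sub_apply, smul_eq_mul]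

end SigmaPencil

end Summit.QuantumFields.BalabanUV.T4Continuum.Spine.NE5.TwoRunPencilDiagonal

end
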